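/-
Copyright (c) 2026 the pub-hodgecm-mathlib formalisation cell (harness21).  Prover seat hodgecm-mathlib-F0P3a-p04 (g19): road «S3-ram» (LEAD F0P3a-plan (g12∕g13); junction
pen F0P3a-p01 (g17), J-PACK v2-iso socket S2 `row_offRegionLabels`; owner F0P3a-p06 (g15)); 2026-09-02.
-/
import Literature.NumberTheory.Automorphic.UnitaryLatticeTreeEigenlinePropagationRamified    -- ★ (this seat): eigenline propagation ∕ pivot at odd level; brings ★ same-level criterion, ★ O-LBL, ★ L, ★ H, ★ F
import HarnessLib

/-!
# The lattice graph of a hermitian space — THE LABELS OF THE OFF-REGION GRANDCHILDREN OF A ROOT-REGION VERTEX (isoceles type-(1) literals, tame-ramified place):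
# socket S2 `row_offRegionLabels` of the junction skeleton v4 (Kottwitz 1986 §3; Rogawski 1990 §4.9; Bruhat–Tits 1972 §10; Tits 1979 §3.5)

Topic `NumberTheory/Automorphic`; namespace `Literature.NumberTheory.Automorphic.UnitaryLatticeTree`.  THEOREMS ONLY (no definition, no instance, no notation, no named fact,
no `sorry`); kernel lane `--supports stmt-HodgeConjecture-24833`.  Cell `pub/hodgecm-mathlib` (D-0151), crux H413; road «S3-ram» (Literature seeding, count-neutral); the
(a2) JUNCTION of the type-(1) ramified row, second wave J-PACK v2-iso (pen F0P3a-p01 (g17); skeleton v4 `F0/P3a/F0P3a-p01/g17/junction/JunctionSockets.skeleton.v4…lean`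
e89e5e06e7d3b45d :417): **S2 «OFF-REGION GRANDCHILD LABELS AT A REGION VERTEX»**, binders VERBATIM (unused ones `_`-prefixed).

THE ROW.  The isoceles literals run on ★ ENGINE ED. 3 with the ROOT REGION `R = {v ∈ Fix | SD v ∧ LEV[v](ϖ^{d₀})}`; at a region vertex `v = u·r₀` (`u ∈ U(σ,J₀)`; fixed,
self-dual, `(γ−1)·v ⊆ ϖ^{d₀}·v`) the child `(uκ)·N₁` (`κ ∈ K₀`) is keyed by the depth-`d₀` VALUE `t = ϖ^{−d₀}·B₀(κe₀, (u⁻¹γu − 1)κe₀)` of its line, and a far vertex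
`w ≠ v` through it OUTSIDE the region (`¬LEV[w](ϖ^{d₀})`) carries: the `E`-label `LEV(ϖ^{d₀−1}) ∧ ¬LEV(ϖ^{d₀}) ∧ ¬LEV₂(ϖ^{2d₀−1})` if `t` is NULL, the `P`-label
`LEV(ϖ^{d₀−2}) ∧ ¬LEV(ϖ^{d₀−1}) ∧ LEV₂(ϖ^{2d₀−3}) ∧ CLS(d₀−2)(−t)` if `t` is a UNIT.  PROOF (uniform in `v`: root, interior or boundary of the region — no `SS` ∕
semisimplicity key).  Frame: `w = latt((uκ)·g(a,b))` (★ D pulled back along `uκ`, as ★ FILE L), `M = (uκ)⁻¹(γ−1)(uκ) = κ⁻¹·(u⁻¹(γ−1)u)·κ` of level `ϖ^{d₀}` (★ H §0 on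
`v = latt u`, `κ ∈ K₀`), corner `M₂₀ =` the value (★ `pairing_coe_mulVec_single_eq_inv_mul_mul_apply` ∘ ★ `coe_inv_mul_mul_sub_one`).  `d₀` is ODD: the eigenvalues
`s_{i₀}, s_j` are norm-one units with `|s_{i₀} − s_j| = |ϖ|^{d₀}` (★ `odd_of_v_sub_eq_of_mul_map_eq_one`).  NULL: the corner passes; since `w` drops the level, the line is
NOT an eigenline — ★ EIGENLINE PROPAGATION AT ODD LEVEL in pivot form (`v_one_zero_eq_of_corner_of_not_map_sub_one_childLatt_le`: `|M₁₀| = |ϖ|^{d₀}`), then ★ H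
`…_pred_iff` ∕ `map_sub_one_sq_childLatt_le_scaleLattice_iff_of_corner`.  UNIT: ★ O-LBL `childLabels_of_not_null` + ★ H `exists_mem_childLatt_class_neg_of_lineClass`
(`a₀ = 1`), exactly as the equilateral root row ★ p847534.

* **`offRegionGrandchildLabels`** (= socket `row_offRegionLabels`, closes by `exact`).

HONEST LABEL: HC_CM is proved only modulo the 2 remaining named inputs (hLiu418 24832, h413 24833) until rung 0 closes; nothing printed is asserted here (elementary algebra
over a valuation ring); «S3-ram» has no books consequence.

## References
* [Kottwitz1986] R. E. Kottwitz, *Base change for unit elements of Hecke algebras*, Compositio Math. 60 (1986), §3 (levels of fixed lattices; shell recursion).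
* [Rogawski1990] J. D. Rogawski, *Automorphic Representations of Unitary Groups in Three Variables*, Ann. of Math. Stud. 123 (1990), §4.9 pp. 54–56 (the two configurations
  of a type-(1) torus at a ramified place).
* [BruhatTits1972] F. Bruhat, J. Tits, *Groupes réductifs sur un corps local I*, Publ. Math. IHÉS 41 (1972), §10 (lattice models; vertex stabilisers and their filtrations).
* [Tits1979] J. Tits, *Reductive groups over local fields*, PSPM 33.1 (1979), §3.5 (congruence filtration; reduction mod `𝔭`).
* [Serre1980Trees] J.-P. Serre, *Trees* (1980), Ch. II §1.1–1.2 (lattices, neighbours, levels).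
-/

set_option autoImplicit false

noncomputable section

open scoped Valued WithZero Matrix MatrixGroups

namespace Literature.NumberTheory.Automorphic.UnitaryLatticeTree

open Literature.NumberTheory.Automorphic Literature.NumberTheory.Automorphic.HermitianLattice

variable {K : Type*} [Field K] [Valued K ℤᵐ⁰] {σ : K →+* K} {ϖ : K}

/-- **S2 «OFF-REGION GRANDCHILD LABELS AT A REGION VERTEX»** (socket `row_offRegionLabels` of the junction skeleton v4, binders verbatim; ROW-ROOT-LBL generalised from `r₀`
to any region vertex `v = u·r₀` and to the isoceles eigen-data).  The child `(uκ)·N₁` is keyed by its depth-`d₀` line value `t = (ϖ^d₀)⁻¹·B₀(κe₀, (u⁻¹γu − 1)κe₀)`;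
a far vertex `w` through it OUTSIDE the region (`¬LEV[w](ϖ^d₀)`) has the E-label `(d₀−1, 2)` if `t` is null and the P-label `(d₀−2, 1, CLS(−t))` if `t` is a unit.
Uniform in `v` (root ∕ interior ∕ boundary): NULL ⇒ pivot by ★ eigenline propagation at the odd level `d₀` (`d₀` odd from the norm-one eigenvalues), UNIT ⇒ ★ O-LBL +
★ H class token. [cite: Kottwitz1986, §3] [cite: Rogawski1990, §4.9 pp. 54–56] [cite: BruhatTits1972, §10] [cite: Tits1979, §3.5] -/
theorem offRegionGrandchildLabels (hσ : ∀ x, σ (σ x) = x) (hvσ : ∀ a, Valued.v (σ a) = Valued.v a) (hσϖ : σ ϖ = -ϖ)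
    (hϖ : Valued.v ϖ = WithZero.exp (-1 : ℤ)) (hres : ∀ x : K, Valued.v x ≤ 1 → Valued.v (σ x - x) < 1) (h2 : Valued.v (2 : K) = 1) [Finite 𝓀[K]]
    (_hT : (latticeGraph σ ϖ ((StdForm.antidiagonal 3).over K)).IsTree)
    {γ : unitaryGroupOfForm σ ((StdForm.antidiagonal 3).over K)} (_hγ0 : γ ∈ unitaryInt σ ((StdForm.antidiagonal 3).over K))
    (_hnorm : ∀ u : K, σ u = u → Valued.v (u - 1) < 1 → ∃ z : K, z * σ z = u ∧ Valued.v (z - 1) ≤ Valued.v (u - 1))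
    (d : Fin 3 → K) (_hd : ∀ i, Valued.v (d i) = 1) (_hdσ : ∀ i, σ (d i) = d i)
    (A : GL (Fin 3) K) (_hA : IsIntMatrix (A : Matrix (Fin 3) (Fin 3) K)) (_hA' : IsIntMatrix ((A⁻¹ : GL (Fin 3) K) : Matrix (Fin 3) (Fin 3) K))
    (_hdA : Matrix.diagonal d = (-(Matrix.diagonal d).det) • formCongr σ A ((StdForm.antidiagonal 3).over K))
    (s : Fin 3 → K) (_hs1 : s 1 = 1) (_hsv : ∀ i, Valued.v (s i) = 1) (hsσ : ∀ i, s i * σ (s i) = 1)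
    (_hγA : ((γ : GL (Fin 3) K) : Matrix (Fin 3) (Fin 3) K) = (A : Matrix (Fin 3) (Fin 3) K) * Matrix.diagonal s * ((A⁻¹ : GL (Fin 3) K) : Matrix (Fin 3) (Fin 3) K))
    (i₀ : Fin 3) {d₀ : ℕ} (hd3 : 3 ≤ d₀) (_he : ∀ i, Valued.v (s i - 1) ≤ Valued.v ϖ ^ d₀)
    (hiso : ∀ j, j ≠ i₀ → Valued.v (s i₀ - s j) = Valued.v ϖ ^ d₀) (_hclose : ∀ j k, j ≠ i₀ → k ≠ i₀ → Valued.v (s j - s k) ≤ Valued.v ϖ ^ (d₀ + 2))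
    (u : unitaryGroupOfForm σ ((StdForm.antidiagonal 3).over K)) {v : {M : Submodule 𝒪[K] (Fin 3 → K) // IsVertex σ ϖ ((StdForm.antidiagonal 3).over K) M}} (hvu : v = latticeGraphIso σ ϖ ((StdForm.antidiagonal 3).over K) u ⟨stdLattice K 3, 0, isSelfDualLattice_stdLattice_three_of_v hϖ⟩)
    (_hv : IsSelfDualLattice σ ϖ ((StdForm.antidiagonal 3).over K) v.1) (_hfix : latticeGraphIso σ ϖ ((StdForm.antidiagonal 3).over K) γ v = v) (hvR : v.1.map ((Matrix.toLin' (((γ : GL (Fin 3) K) : Matrix (Fin 3) (Fin 3) K) - 1)).restrictScalars 𝒪[K]) ≤ scaleLattice (ϖ ^ d₀) v.1)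
    (κ : unitaryGroupOfForm σ ((StdForm.antidiagonal 3).over K)) (hκ : κ ∈ unitaryInt σ ((StdForm.antidiagonal 3).over K))
    {w : {M : Submodule 𝒪[K] (Fin 3 → K) // IsVertex σ ϖ ((StdForm.antidiagonal 3).over K) M}} (_hw : IsSelfDualLattice σ ϖ ((StdForm.antidiagonal 3).over K) w.1) (_hfixw : latticeGraphIso σ ϖ ((StdForm.antidiagonal 3).over K) γ w = w) (hwv : w ≠ v)
    (hcw : (latticeGraph σ ϖ ((StdForm.antidiagonal 3).over K)).Adj (latticeGraphIso σ ϖ ((StdForm.antidiagonal 3).over K) (u * κ) ⟨latt (Matrix.diagonal ![(1 : K), 1, ϖ]), 2, isVertexLattice_two_N₁_of_neg hσϖ hϖ⟩) w)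
    (hwR : ¬ w.1.map ((Matrix.toLin' (((γ : GL (Fin 3) K) : Matrix (Fin 3) (Fin 3) K) - 1)).restrictScalars 𝒪[K]) ≤ scaleLattice (ϖ ^ d₀) w.1) :
    (Valued.v ((ϖ ^ d₀)⁻¹ * pairing σ ((StdForm.antidiagonal 3).over K) (((κ : GL (Fin 3) K) : Matrix (Fin 3) (Fin 3) K) *ᵥ Pi.single 0 1) (((((u⁻¹ * γ * u : unitaryGroupOfForm σ ((StdForm.antidiagonal 3).over K)) : GL (Fin 3) K) : Matrix (Fin 3) (Fin 3) K) - 1) *ᵥ (((κ : GL (Fin 3) K) : Matrix (Fin 3) (Fin 3) K) *ᵥ Pi.single 0 1))) < 1 →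
        w.1.map ((Matrix.toLin' (((γ : GL (Fin 3) K) : Matrix (Fin 3) (Fin 3) K) - 1)).restrictScalars 𝒪[K]) ≤ scaleLattice (ϖ ^ (d₀ - 1)) w.1 ∧ ¬ w.1.map ((Matrix.toLin' (((γ : GL (Fin 3) K) : Matrix (Fin 3) (Fin 3) K) - 1)).restrictScalars 𝒪[K]) ≤ scaleLattice (ϖ ^ d₀) w.1 ∧ ¬ w.1.map ((Matrix.toLin' ((((γ : GL (Fin 3) K) : Matrix (Fin 3) (Fin 3) K) - 1) ^ 2)).restrictScalars 𝒪[K]) ≤ scaleLattice (ϖ ^ (2 * d₀ - 1)) w.1) ∧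
      (∀ t : K, Valued.v t = 1 → Valued.v (((ϖ ^ d₀)⁻¹ * pairing σ ((StdForm.antidiagonal 3).over K) (((κ : GL (Fin 3) K) : Matrix (Fin 3) (Fin 3) K) *ᵥ Pi.single 0 1) (((((u⁻¹ * γ * u : unitaryGroupOfForm σ ((StdForm.antidiagonal 3).over K)) : GL (Fin 3) K) : Matrix (Fin 3) (Fin 3) K) - 1) *ᵥ (((κ : GL (Fin 3) K) : Matrix (Fin 3) (Fin 3) K) *ᵥ Pi.single 0 1))) - t) < 1 →
        w.1.map ((Matrix.toLin' (((γ : GL (Fin 3) K) : Matrix (Fin 3) (Fin 3) K) - 1)).restrictScalars 𝒪[K]) ≤ scaleLattice (ϖ ^ (d₀ - 2)) w.1 ∧ ¬ w.1.map ((Matrix.toLin' (((γ : GL (Fin 3) K) : Matrix (Fin 3) (Fin 3) K) - 1)).restrictScalars 𝒪[K]) ≤ scaleLattice (ϖ ^ (d₀ - 1)) w.1 ∧ w.1.map ((Matrix.toLin' ((((γ : GL (Fin 3) K) : Matrix (Fin 3) (Fin 3) K) - 1) ^ 2)).restrictScalars 𝒪[K]) ≤ scaleLattice (ϖ ^ (2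 * d₀ - 3)) w.1 ∧
          (∃ y ∈ w.1, ∃ a : K, Valued.v a = 1 ∧ Valued.v ((ϖ ^ (d₀ - 2))⁻¹ * pairing σ ((StdForm.antidiagonal 3).over K) y ((((γ : GL (Fin 3) K) : Matrix (Fin 3) (Fin 3) K) - 1) *ᵥ y) - (-t) * a ^ 2) < 1)) := by
  have hϖ0 : ϖ ≠ 0 := fun h0 => by rw [h0, map_zero] at hϖ; exact WithZero.coe_ne_zero hϖ.symm
  have hvϖ0 : Valued.v ϖ ≠ 0 := (Valuation.ne_zero_iff _).2 hϖ0
  have hϖlt : Valued.v ϖ < 1 := by rw [hϖ, ← WithZero.exp_zero]; exact WithZero.exp_lt_exp.2 (by norm_num)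
  have hd1 : 1 ≤ d₀ := by omega
  have hd2 : 2 ≤ d₀ := by omega
  -- `d₀` is ODD: `s i₀`, `s j` are norm-one units at distance `|ϖ|^{d₀}`
  obtain ⟨j, hj⟩ := exists_ne i₀
  have hodd : Odd d₀ := odd_of_v_sub_eq_of_mul_map_eq_one hσ hvσ hσϖ hϖ hres h2 (hsσ i₀) (hsσ j) (by omega) (hiso j hj)
  -- STEP A — the frame of the grandchild: `w = latt((uκ)·g(a,b))`, `|a| = 1`, `|b| ≤ 1` (★ D pulled back along `uκ`)
  obtain ⟨a, b, ha, hb, hw1⟩ : ∃ a b : K, Valued.v a = 1 ∧ Valued.v b ≤ 1 ∧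
      w.1 = latt ((((u * κ : unitaryGroupOfForm σ ((StdForm.antidiagonal 3).over K)) : GL (Fin 3) K) : Matrix (Fin 3) (Fin 3) K) * !![a / ϖ, 0, 0; 0, 1, 0; b, 0, ϖ]) := by
    set w' := latticeGraphIso σ ϖ ((StdForm.antidiagonal 3).over K) (u * κ)⁻¹ w with hw'def
    have hww' : latticeGraphIso σ ϖ ((StdForm.antidiagonal 3).over K) (u * κ) w' = w := latticeGraphIso_mul_inv_apply _ _
    have hw' : w' ∈ (latticeGraph σ ϖ ((StdForm.antidiagonal 3).over K)).neighborSet ⟨latt (Matrix.diagonal ![(1 : K), 1, ϖ]), 2, isVertexLattice_two_N₁_of_neg hσϖ hϖ⟩ := by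
      rw [SimpleGraph.mem_neighborSet]
      rw [← hww'] at hcw
      exact (latticeGraphIso σ ϖ ((StdForm.antidiagonal 3).over K) (u * κ)).map_adj_iff.1 hcw
    have hne' : w'.1 ≠ stdLattice K 3 := by
      intro h
      apply hwv
      have hroot : w' = ⟨stdLattice K 3, 0, isSelfDualLattice_stdLattice_three_of_v hϖ⟩ := Subtype.ext h
      rw [← hww', hroot, latticeGraphIso_mul_apply, latticeGraphIso_root_eq_of_mem_unitaryInt hϖ hκ, ← hvu]
    obtain ⟨a, b, ha, hb, hw'1⟩ := exists_unit_vec_of_mem_neighborSet_N₁_of_ne_stdLattice hvσ hσϖ hϖ hres hw' hne'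
    refine ⟨a, b, ha, hb, ?_⟩
    rw [← hww', latticeGraphIso_apply_val, hw'1, latt_coe_mul_childFrame_eq hϖ _ ha hb]
  -- STEP B — the element in the frame: `M = (uκ)⁻¹(γ−1)(uκ) = κ⁻¹·(u⁻¹(γ−1)u)·κ`, of level `ϖ^{d₀}` because `v = latt u` is a region vertex and `κ ∈ K₀`
  set M : Matrix (Fin 3) (Fin 3) K := ((((u * κ : unitaryGroupOfForm σ ((StdForm.antidiagonal 3).over K)) : GL (Fin 3) K)⁻¹ : GL (Fin 3) K) : Matrix (Fin 3) (Fin 3) K) *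
      (((γ : GL (Fin 3) K) : Matrix (Fin 3) (Fin 3) K) - 1) * (((u * κ : unitaryGroupOfForm σ ((StdForm.antidiagonal 3).over K)) : GL (Fin 3) K) : Matrix (Fin 3) (Fin 3) K)
    with hMdef
  have hMeq : M = (((κ : GL (Fin 3) K)⁻¹ : GL (Fin 3) K) : Matrix (Fin 3) (Fin 3) K) *
      ((((u : GL (Fin 3) K)⁻¹ : GL (Fin 3) K) : Matrix (Fin 3) (Fin 3) K) * (((γ : GL (Fin 3) K) : Matrix (Fin 3) (Fin 3) K) - 1) * ((u : GL (Fin 3) K) : Matrix (Fin 3) (Fin 3) K)) *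
      ((κ : GL (Fin 3) K) : Matrix (Fin 3) (Fin 3) K) := by
    rw [hMdef, Subgroup.coe_mul, mul_inv_rev, Units.val_mul, Units.val_mul]
    simp only [Matrix.mul_assoc]
  have hv1 : v.1 = latt ((u : GL (Fin 3) K) : Matrix (Fin 3) (Fin 3) K) := by rw [hvu, latticeGraphIso_apply_val]; rfl
  have hY : ∀ i k, Valued.v (((((u : GL (Fin 3) K)⁻¹ : GL (Fin 3) K) : Matrix (Fin 3) (Fin 3) K) * (((γ : GL (Fin 3) K) : Matrix (Fin 3) (Fin 3) K) - 1) *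
      ((u : GL (Fin 3) K) : Matrix (Fin 3) (Fin 3) K)) i k) ≤ Valued.v ϖ ^ d₀ := by
    have h := hvR
    rw [hv1, map_toLin'_latt_le_scaleLattice_iff (pow_ne_zero _ hϖ0) _ (Matrix.isUnits_det_units _), map_pow, ← Matrix.coe_units_inv] at h
    exact h
  have hκi := (mem_unitaryInt_iff.1 hκ).1
  have hκi' := (mem_unitaryInt_iff.1 hκ).2
  have hM : ∀ i k, Valued.v (M i k) ≤ Valued.v ϖ ^ d₀ := by
    intro i k; rw [hMeq]; exact v_mul_mul_apply_le_of_le hκi' hY hκi i k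
  -- STEP C — the corner is the value of the line
  have hcorner : pairing σ ((StdForm.antidiagonal 3).over K) (((κ : GL (Fin 3) K) : Matrix (Fin 3) (Fin 3) K) *ᵥ Pi.single 0 1)
      (((((u⁻¹ * γ * u : unitaryGroupOfForm σ ((StdForm.antidiagonal 3).over K)) : GL (Fin 3) K) : Matrix (Fin 3) (Fin 3) K) - 1) *ᵥ
        (((κ : GL (Fin 3) K) : Matrix (Fin 3) (Fin 3) K) *ᵥ Pi.single 0 1)) = M 2 0 := by
    rw [pairing_coe_mulVec_single_eq_inv_mul_mul_apply κ, coe_inv_mul_mul_sub_one γ u, hMeq]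
  have hpowne : Valued.v ϖ ^ d₀ ≠ 0 := pow_ne_zero _ hvϖ0
  have hscale : ∀ x : K, Valued.v ((ϖ ^ d₀)⁻¹ * x) = (Valued.v ϖ ^ d₀)⁻¹ * Valued.v x := fun x => by rw [map_mul, map_inv₀, map_pow]
  have hnot : ¬ (latt ((((u * κ : unitaryGroupOfForm σ ((StdForm.antidiagonal 3).over K)) : GL (Fin 3) K) : Matrix (Fin 3) (Fin 3) K) * !![a / ϖ, 0, 0; 0, 1, 0; b, 0, ϖ])).map
        ((Matrix.toLin' (((γ : GL (Fin 3) K) : Matrix (Fin 3) (Fin 3) K) - 1)).restrictScalars 𝒪[K]) ≤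
      scaleLattice (ϖ ^ d₀) (latt ((((u * κ : unitaryGroupOfForm σ ((StdForm.antidiagonal 3).over K)) : GL (Fin 3) K) : Matrix (Fin 3) (Fin 3) K) * !![a / ϖ, 0, 0; 0, 1, 0; b, 0, ϖ])) := by
    rw [← hw1]; exact hwR
  refine ⟨fun hnull => ?_, fun t ht hclose_t => ?_⟩
  · -- NULL line: the corner passes; `w` drops the level, so the line is NOT an eigenline — pivot `|M₁₀| = |ϖ|^{d₀}`, label `E = (d₀−1, rank 2)`
    rw [hcorner, hscale] at hnull
    have h20lt : Valued.v (M 2 0) < Valued.v ϖ ^ d₀ := by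
      have h' := mul_lt_mul_of_pos_left hnull (zero_lt_iff.2 hpowne)
      rwa [← mul_assoc, mul_inv_cancel₀ hpowne, one_mul, mul_one] at h'
    have h20 : Valued.v (M 2 0) ≤ Valued.v ϖ ^ (d₀ + 1) := by
      have hdm : Valued.v ϖ ^ d₀ = Valued.v ϖ ^ (d₀ + 1) * WithZero.exp (1 : ℤ) := by
        rw [pow_succ, hϖ, mul_assoc, ← WithZero.exp_add]; norm_num
      rw [hdm] at h20lt
      exact (WithZero.lt_mul_exp_iff_le (pow_ne_zero _ hvϖ0)).1 h20lt
    have h10 : Valued.v (M 1 0) = Valued.v ϖ ^ d₀ :=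
      v_one_zero_eq_of_corner_of_not_map_sub_one_childLatt_le hvσ hσϖ hϖ hres h2 (u * κ) γ ha hb hd2 hodd hM h20 hnot
    rw [hw1]
    exact ⟨(map_sub_one_childLatt_le_scaleLattice_pred_iff hϖ ((u * κ : unitaryGroupOfForm σ ((StdForm.antidiagonal 3).over K)) : GL (Fin 3) K) (γ : GL (Fin 3) K) ha hb hd1 hM).2 h20,
      hnot, fun h => ((map_sub_one_sq_childLatt_le_scaleLattice_iff_of_corner hvσ hϖ (u * κ) γ ha hb hd1 hM h20).1 h) h10⟩
  · -- UNIT line of class `t`: the corner is a unit at order `d₀`, label `P = (d₀−2, rank ≤ 1, class −t)`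
    have h20 : ¬ Valued.v (M 2 0) ≤ Valued.v ϖ ^ (d₀ + 1) := by
      intro hle
      have hsmall : Valued.v ((ϖ ^ d₀)⁻¹ * M 2 0) < 1 := by
        rw [hscale]
        calc (Valued.v ϖ ^ d₀)⁻¹ * Valued.v (M 2 0) ≤ (Valued.v ϖ ^ d₀)⁻¹ * Valued.v ϖ ^ (d₀ + 1) := mul_le_mul' le_rfl hle
          _ = Valued.v ϖ := by rw [pow_succ, ← mul_assoc, inv_mul_cancel₀ hpowne, one_mul]
          _ < 1 := hϖlt
      rw [hcorner] at hclose_t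
      have hsub : Valued.v ((ϖ ^ d₀)⁻¹ * M 2 0 - t) = Valued.v t := by
        rw [← ht] at hsmall
        exact Valuation.map_sub_eq_of_lt_right _ hsmall
      rw [hsub, ht] at hclose_t
      exact lt_irrefl _ hclose_t
    obtain ⟨hl1, hl2, hl3⟩ := childLabels_of_not_null hϖ (u * κ) γ ha hb hd2 hM h20
    rw [hw1]
    refine ⟨hl1, hl2, hl3, ?_⟩
    refine exists_mem_childLatt_class_neg_of_lineClass hvσ hσϖ hϖ hres (u * κ) γ ha hb hd2 hM ⟨1, by rw [map_one], ?_⟩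
    rw [one_pow, mul_one]
    rw [hcorner] at hclose_t
    exact hclose_t

end Literature.NumberTheory.Automorphic.UnitaryLatticeTree

end
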